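import Summits.QuantumFields.QCD.Theorems.QuarksAsStableActionStableActionBridgeChainBlockDet
import Literature.MathematicalPhysics.QuantumLattice.WilsonDiracAP

/-!
# Positivity of the chain-block prefactor `∏_t det E_t` for antiperiodic `SU(N)` quarks
(helper for crux stmt-QuantumFields-9737 `QuarksAsStableAction.StableActionBridge`, line `Sketch`;
stub `prod_det_apChainBlock_pos`)

In Lüscher's transfer-matrix form of the antiperiodic `r = 1` Wilson fermion determinant,
`apDet U m = (∏_t det E_t) · det (1 + ∏_t M_t Ŵ_t)` (`apDet_transfer_form`), the chain blocks are
`E_t = A_t P⁻ − P⁺ W′_{t−1}` for the antiperiodic `U(N)` lift `apLift U` of the `SU(N)` field `U`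
in the defining representation.  By `det_wilson_chainBlock`,
`det E_t = det(w′_{t−1})² · det(B_t)²` with `w′_s` the site-block-diagonal colour matrix of the
inverse temporal links of slice `s` and `B_t = (m + 4) − ½ Σ_j (H_j + H_j⁻)` the spin-blind slice
operator.  This file shows that for `m > −1` the prefactor `∏_t det E_t` is a POSITIVE REAL:

* `B_t` is Hermitian positive definite (`WilsonTransfer.sliceOp_posDef`, the hops of a unitary
  representation are isometries and `3 < m + 4`), so `0 < det B_t` in `ℂ` (`Matrix.PosDef.det_pos`)
  and `0 < det(B_t)²`;
* `w′_s` is block diagonal over the spatial sites with blocks `(apLift U e)⁻¹ ∈ U(N)`, and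
  `apLift U e = ±V` with `V ∈ SU(N)`, so each block determinant `d` has `d² = 1`
  (`det(±V)² = ((−1)^N)² · (det V)² = 1` and `det(g⁻¹) · det g = 1`), whence `det(w′_s)² = 1`
  (`Matrix.det_blockDiagonal` after reindexing along `Equiv.prodComm`);
* a finite product of positive elements of `ℂ` (Mathlib's `ComplexOrder`: `0 < z ↔ 0 < re z ∧ im z = 0`)
  is positive (`Finset.prod_pos`).

References: [Luscher1977, pp. 283–292]; [MontvayMunster1994, §4.2.3 (4.111)]; prose: Smit,
*Introduction to Quantum Fields on a Lattice*, §6.5.  Pure theorem file (no definitions).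
-/

noncomputable section

namespace Summit.QuantumFields.QCD.Cruxes.StableActionBridge.Sketch

open scoped ComplexOrder Kronecker
open Literature.MathematicalPhysics.QuantumFieldTheory Literature.MathematicalPhysics.QuantumLattice
open Literature.Probability.LatticeModels (TorusSite)

namespace APChainBlockPos

open Matrix

/-! ### Site-block-diagonal colour matrices -/

/-- A site-block-diagonal matrix on `X × Y` (blocks `u x` on the `Y`-factor) is Mathlib's
`Matrix.blockDiagonal u`, reindexed along `Equiv.prodComm`. -/
theorem of_siteBlockDiag_eq {X Y : Type*} [DecidableEq X] (u : X → Matrix Y Y ℂ) :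
    (Matrix.of fun p q : X × Y => if p.1 = q.1 then u p.1 p.2 q.2 else 0) =
      Matrix.reindex (Equiv.prodComm Y X) (Equiv.prodComm Y X) (Matrix.blockDiagonal u) := by
  ext ⟨x, a⟩ ⟨y, b⟩
  simp only [Matrix.of_apply, Matrix.reindex_apply, Matrix.submatrix_apply, Equiv.prodComm_symm,
    Equiv.prodComm_apply, Prod.swap_prod_mk, Matrix.blockDiagonal_apply]

/-- The determinant of a site-block-diagonal matrix is the product of the block determinants. -/
theorem det_of_siteBlockDiag {X Y : Type*} [Fintype X] [DecidableEq X] [Fintype Y] [DecidableEq Y]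
    (u : X → Matrix Y Y ℂ) :
    (Matrix.of fun p q : X × Y => if p.1 = q.1 then u p.1 p.2 q.2 else 0).det = ∏ x, (u x).det := by
  rw [of_siteBlockDiag_eq, Matrix.det_reindex_self, Matrix.det_blockDiagonal]

/-! ### Determinants of the antiperiodic links -/

variable {d L N : ℕ}

/-- The links of the antiperiodic lift are `±V` with `V ∈ SU(N)`, so their determinants square
to one: `det(±V)² = ((−1)^N · det V)² = 1`. -/
theorem det_coe_apLift_sq (U : GaugeConfig d L (Matrix.specialUnitaryGroup (Fin N) ℂ)) (e : Edge d L) :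
    ((apLift U e : Matrix.unitaryGroup (Fin N) ℂ) : Matrix (Fin N) (Fin N) ℂ).det ^ 2 = 1 := by
  have hU : (U e : Matrix (Fin N) (Fin N) ℂ).det = 1 :=
    (Matrix.mem_specialUnitaryGroup_iff.1 (U e).2).2
  rw [coe_apLift_apply]
  split_ifs
  · rw [Matrix.det_neg, hU, mul_one, ← pow_mul, pow_mul', neg_one_sq, one_pow]
  · rw [hU, one_pow]

/-- The inverse links of the antiperiodic lift have determinants squaring to one
(`det(g⁻¹) · det g = 1` in `U(N)` and `det(g)² = 1`). -/
theorem det_coe_apLift_inv_sq (U : GaugeConfig d L (Matrix.specialUnitaryGroup (Fin N) ℂ))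
    (e : Edge d L) :
    (((apLift U e)⁻¹ : Matrix.unitaryGroup (Fin N) ℂ) : Matrix (Fin N) (Fin N) ℂ).det ^ 2 = 1 := by
  have hmul : (((apLift U e)⁻¹ : Matrix.unitaryGroup (Fin N) ℂ) : Matrix (Fin N) (Fin N) ℂ).det *
      ((apLift U e : Matrix.unitaryGroup (Fin N) ℂ) : Matrix (Fin N) (Fin N) ℂ).det = 1 := by
    rw [← Matrix.det_mul, ← Matrix.UnitaryGroup.mul_val, inv_mul_cancel, Matrix.UnitaryGroup.one_val,
      Matrix.det_one]
  calc (((apLift U e)⁻¹ : Matrix.unitaryGroup (Fin N) ℂ) : Matrix (Fin N) (Fin N) ℂ).det ^ 2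
      = (((apLift U e)⁻¹ : Matrix.unitaryGroup (Fin N) ℂ) : Matrix (Fin N) (Fin N) ℂ).det ^ 2 *
          ((apLift U e : Matrix.unitaryGroup (Fin N) ℂ) : Matrix (Fin N) (Fin N) ℂ).det ^ 2 := by
        rw [det_coe_apLift_sq, mul_one]
    _ = 1 := by rw [← mul_pow, hmul, one_pow]

/-- **`det(w′_s)² = 1`** for the site-block-diagonal colour matrix `w′_s` of the inverse temporal
links of slice `s` of the antiperiodic lift of an `SU(N)` field (defining representation). -/
theorem det_invTimeLink_sq [NeZero L] (U : GaugeConfig 4 L (Matrix.specialUnitaryGroup (Fin N) ℂ))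
    (s : ZMod L) :
    (Matrix.of fun p q : TorusSite 3 L × Fin N =>
        if p.1 = q.1 then
          unitaryFundamentalRep (Fin N) ℂ (apLift U ((Fin.cons s p.1 : TorusSite 4 L), 0))⁻¹ p.2 q.2
        else 0).det ^ 2 = 1 := by
  have h : (Matrix.of fun p q : TorusSite 3 L × Fin N =>
        if p.1 = q.1 then
          unitaryFundamentalRep (Fin N) ℂ (apLift U ((Fin.cons s p.1 : TorusSite 4 L), 0))⁻¹ p.2 q.2
        else 0).det =
      ∏ x : TorusSite 3 L,
        (unitaryFundamentalRep (Fin N) ℂ (apLift U ((Fin.cons s x : TorusSite 4 L), 0))⁻¹).det :=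
    det_of_siteBlockDiag fun x : TorusSite 3 L =>
      unitaryFundamentalRep (Fin N) ℂ (apLift U ((Fin.cons s x : TorusSite 4 L), 0))⁻¹
  rw [h, ← Finset.prod_pow]
  exact Finset.prod_eq_one fun x _ => by
    rw [unitaryFundamentalRep_apply]
    exact det_coe_apLift_inv_sq U _

end APChainBlockPos

/-- **Positivity of the chain-block prefactor** (stub `prod_det_apChainBlock_pos` of line `Sketch`):
for the antiperiodic lift of an `SU(N)` lattice gauge field in the defining representation and a
bare mass `m > −1`, the prefactor `∏_t det E_t` of Lüscher's transfer-matrix form of the Wilson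
fermion determinant is a positive real number: `det E_t = det(w′_{t−1})² · det(B_t)²` with
`det(w′_{t−1})² = 1` (unitary `±SU(N)` blocks) and `B_t` Hermitian positive definite.
[cite: Luscher1977, pp. 283–292] -/
theorem prod_det_apChainBlock_pos :
    ∀ (N L : ℕ) [NeZero L] (U : GaugeConfig 4 L (Matrix.specialUnitaryGroup (Fin N) ℂ)) (m : ℝ), -1 < m → let Pp : Matrix (TorusSite 3 L × Fin N × Fin 4) (TorusSite 3 L × Fin N × Fin 4) ℂ := Matrix.of fun a b => if a.1 = b.1 ∧ a.2.1 = b.2.1 then ((1 / 2 : ℂ) • (1 + euclideanGamma 0)) a.2.2 b.2.2 else 0; let Pm : Matrix (TorusSite 3 L × Fin N × Fin 4) (TorusSite 3 L × Fin N × Fin 4) ℂ := Matrix.of fun a b => if a.1 = b.1 ∧ a.2.1 = b.2.1 then ((1 / 2 : ℂ) • (1 - euclideanGamma 0)) a.2.2 b.2.2 else 0; let W' : ZMod L → Matrix (TorusSite 3 L × Fin N × Fin 4) (TorusSite 3 L × Fin N × Fin 4) ℂ := fun t => Matrix.of fun a b => if a.1 = b.1 ∧ a.2.2 = b.2.2 then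 unitaryFundamentalRep (Fin N) ℂ (apLift U ((Fin.cons t a.1 : TorusSite 4 L), 0))⁻¹ a.2.1 b.2.1 else 0; let A : ZMod L → Matrix (TorusSite 3 L × Fin N × Fin 4) (TorusSite 3 L × Fin N × Fin 4) ℂ := fun t => Matrix.of fun a b => (if a = b then ((m + 4 * 1 : ℝ) : ℂ) else 0) - (1 / 2 : ℂ) * ∑ j : Fin 3, ((if b.1 = Literature.MathematicalPhysics.QuantumFieldTheory.Site.shift a.1 j then (((1 : ℝ) : ℂ) • (1 : Matrix (Fin 4) (Fin 4) ℂ) - euclideanGamma j.succ) a.2.2 b.2.2 * unitaryFundamentalRep (Fin N) ℂ (apLift U ((Fin.cons t a.1 : TorusSite 4 L), j.succ)) a.2.1 b.2.1 else 0) + (if a.1 = Literature.MathematicalPhysics.QuantumFieldTheory.Site.shift b.1 j then (((1 : ℝ) : ℂ) • (1 : Matrix (Fin 4) (Fin 4) ℂ) + euclideanGamma j.succ) a.2.2 b.2.2 * unitaryFundamentalRep (Fin N) ℂ (apLift U ((Fin.cons t b.1 : TorusSite 4 L), j.succ))⁻¹ a.2.1 b.2.1 else 0)); 0 < (∏ t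 : ZMod L, (A t * Pm - Pp * W' (t - 1)).det).re ∧ (∏ t : ZMod L, (A t * Pm - Pp * W' (t - 1)).det).im = 0 := by
  intro N L _ U m hm Pp Pm W' A
  -- the spin-blind slice operator `B_t` and the inverse temporal links `w′_s` of `apLift U`
  let B : ZMod L → Matrix (TorusSite 3 L × Fin N) (TorusSite 3 L × Fin N) ℂ := fun t =>
    Matrix.of fun a b =>
      (if a = b then ((m + 4 : ℝ) : ℂ) else 0) -
        (1 / 2 : ℂ) * ∑ j : Fin 3,
          ((if b.1 = Literature.MathematicalPhysics.QuantumFieldTheory.Site.shift a.1 j then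
              unitaryFundamentalRep (Fin N) ℂ (apLift U ((Fin.cons t a.1 : TorusSite 4 L), j.succ)) a.2 b.2
            else 0) +
            (if a.1 = Literature.MathematicalPhysics.QuantumFieldTheory.Site.shift b.1 j then
              unitaryFundamentalRep (Fin N) ℂ (apLift U ((Fin.cons t b.1 : TorusSite 4 L), j.succ))⁻¹ a.2 b.2
            else 0))
  let w' : ZMod L → Matrix (TorusSite 3 L × Fin N) (TorusSite 3 L × Fin N) ℂ := fun s =>
    Matrix.of fun p q =>
      if p.1 = q.1 then
        unitaryFundamentalRep (Fin N) ℂ (apLift U ((Fin.cons s p.1 : TorusSite 4 L), 0))⁻¹ p.2 q.2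
      else 0
  -- `det E_t = det(w′_{t−1})² · det(B_t)²` (landed `det_wilson_chainBlock`, instantiated at the
  -- defining representation of `U(N)` and the antiperiodic lift)
  have hE : ∀ t : ZMod L,
      (A t * Pm - Pp * W' (t - 1)).det = (w' (t - 1)).det ^ 2 * (B t).det ^ 2 := fun t =>
    det_wilson_chainBlock N L (Matrix.unitaryGroup (Fin N) ℂ) (unitaryFundamentalRep (Fin N) ℂ)
      (apLift U) m t
  -- `B_t > 0` (unitary representation, `m > −1`) and `det(w′_s)² = 1` (`±SU(N)` blocks)
  have hB : ∀ t : ZMod L, (B t).PosDef := fun t =>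
    WilsonTransfer.sliceOp_posDef (unitaryFundamentalRep (Fin N) ℂ)
      unitaryFundamentalRep_mem_unitaryGroup (apLift U) hm t
  have hw : ∀ s : ZMod L, (w' s).det ^ 2 = 1 := fun s => APChainBlockPos.det_invTimeLink_sq U s
  have hpos : ∀ t : ZMod L, 0 < (A t * Pm - Pp * W' (t - 1)).det := fun t => by
    rw [hE, hw, one_mul]
    exact pow_pos (hB t).det_pos 2
  -- a finite product of positive elements of `ℂ` is positive, i.e. a positive real
  have h := Complex.pos_iff.1 (Finset.prod_pos fun t (_ : t ∈ Finset.univ) => hpos t)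
  exact ⟨h.1, h.2.symm⟩

end Summit.QuantumFields.QCD.Cruxes.StableActionBridge.Sketch

end
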